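import Literature.AnabelianGeometry.EtaleTheta.Discharge.Sec1Thm16iiiOfRootClauses
import Literature.AnabelianGeometry.EtaleTheta.Discharge.Sec2Cor218Cor219AtModelChi
import Literature.AnabelianGeometry.EtaleTheta.SettingModelChiInvClauses
import Literature.AnabelianGeometry.EtaleTheta.SettingModelChiProp15ii
import Literature.AnabelianGeometry.EtaleTheta.SettingModelHasThetaTopology
import Literature.AnabelianGeometry.EtaleTheta.SettingModelChiTate2
import HarnessLib

/-!
# [EtTh] Prop. 1.5 (ii) «F̈¹/F̈² = Ẑ · log(Ü)»: the root predicate `Prop15iiQuot` WITNESSED at the χ-model —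
# clause (a) «log(Ü) restricts on (Δ^tp_Ÿ)^Θ to the standard logarithm» (proof-only)

Mochizuki, *The étale theta function and its Frobenioid-theoretic manifestations*, Publ. RIMS **45** (2009) [EtTh],
Prop. 1.5 (ii) p. 23: «F̈¹/F̈² = Hom((Δ^tp_Ÿ)^ell, Δ_Θ) = Ẑ · log(Ü)», «log(Ü) := ½ · log(U)» [cite: MochizukiEtTh2009, Prop 1.5 (ii) p.23].
abc-iut cell, layer L2, prover abc-iut-L2-d1 (gen 5); PROOF-ONLY answer to abc-iut-L2-t1's 12:15Z offer (GAP chain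
D-G-L2t1-1): at abc-iut-L2-t1's `ThetaSetting.modelχ p`, for abc-iut-w5-d029's SECTION Kummer datum `kummerDataχSec p`
(whose `log(Ü)` is abc-iut-w5-d171's `logUddχ`, the class of the halved `y`-coordinate cocycle `logUddFunχ`):

* `augTheta_eq_one_of_mem_dtpYddTheta`, `yThetaχ_mul_of_mem_dtpYddTheta`, `logUddFunχ_mul_of_mem_dtpYddTheta` — on
  `(Δ^tp_Ÿ)^Θ` (`aug^Θ = 1`, so `χ = 1`) the crossed homomorphism `ŷ` and the cocycle `c^{ŷ/2}` are HOMOMORPHISMS;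
* `logUddFunχ_eq_one_iff`, `yThetaχ_eq_one_iff_mem_deltaTheta` — `c^{ŷ(h)/2} = 1 ↔ ŷ(h) = 1 ↔ h ∈ Δ_Θ` on `(Δ^tp_Ÿ)^Θ`;
* `inl_bPowGfp_sq_mem_dtpYddN_one`, `logUddFunχ_toTheta_inl_bPowGfp_sq` — `inl(b^{s²}) ∈ Δ^tp_Ÿ` with `c^{ŷ/2} = c^s`;
* **`exists_stdLog_modelχ`** — hence the restriction `λ` of `c^{ŷ/2}` to `(Δ^tp_Ÿ)^Θ` is a continuous homomorphism
  onto `Δ_Θ` with kernel `Δ_Θ` (abc-iut-L2-t1's `IsStdLog`), agreeing with `logUddFunχ`;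
* **`prop15iiQuot_kummerDataχSec : Prop15iiQuot (kummerDataχSec p) (compat_modelχ p)`** — UNCONDITIONAL, by
  abc-iut-L2-t1's `prop15iiQuot_of_stdLog_of_hasThetaTopology` (clauses (b), (c) from (a) + `HasThetaTopology` +
  `IsEtThOrigin`) over abc-iut-f-150's `compat_modelχ`, abc-iut-w5-d111's `hasThetaTopology_modelχ`,
  abc-iut-L2-t1's `modelχ_isEtThOrigin`; clause (a) `hres` holds by definition of `λ`;
* corollaries BY NAME: `hL_modelχ` (`log(Ü)^n ∈ F̈² → n = 0`), `htf_modelχ`, **`invNegatesFdd1Quot_modelχ`** (for every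
  theta companion of the twisted inversion, `ι` acts by `−1` on `F̈¹/F̈²` — abc-iut-L2-t1's
  `IsInversionAut.invNegatesFdd1Quot` over this seat's `isInversionAut_twistedInversion_modelχ`), and the NV
  `ThetaSetting.exists_isEtThOrigin_prop15iiQuot`.
SEMI-SYNTHETIC MODEL, consistency evidence only; nothing of [EtTh] asserted; no side taken on [IUTchIII] Cor. 3.12.
-/

noncomputable section

namespace Literature.AnabelianGeometry.EtaleTheta.SettingModel

open Literature.AnabelianGeometry.SemiGraphs _root_.Function

variable (p : ℕ) [Fact p.Prime]

/-! ### On `(Δ^tp_Ÿ)^Θ` the `y`-coordinate is a homomorphism -/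

/-- `aug^Θ = 1` on `(Δ^tp_Ÿ)^Θ`. [cite: MochizukiEtTh2009, §1 p.12] -/
theorem augTheta_eq_one_of_mem_dtpYddTheta {h : CurveTheta.GTheta (curveχ p)}
    (hh : h ∈ ((ThetaSetting.modelχ p).DtpYddN 1).map (ThetaSetting.modelχ p).toTheta) :
    CurveTheta.augTheta (curveχ p) h = 1 := by
  obtain ⟨g, hg, rfl⟩ := hh
  exact (Subgroup.mem_inf.mp hg).2

/-- **`ŷ(xy) = ŷ(x)·ŷ(y)` for `x ∈ (Δ^tp_Ÿ)^Θ`** (the crossed law with `χ(aug^Θ x) = χ(1) = 1`).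
[cite: MochizukiEtTh2009, Prop 1.5 (ii) p.23] -/
theorem yThetaχ_mul_of_mem_dtpYddTheta {x : CurveTheta.GTheta (curveχ p)}
    (hx : x ∈ ((ThetaSetting.modelχ p).DtpYddN 1).map (ThetaSetting.modelχ p).toTheta)
    (y : CurveTheta.GTheta (curveχ p)) : yThetaχ p (x * y) = yThetaχ p x * yThetaχ p y := by
  rw [yThetaχ_mul, augTheta_eq_one_of_mem_dtpYddTheta p hx, map_one, MulAut.one_apply]

/-- **`c^{ŷ(xy)/2} = c^{ŷ(x)/2} · c^{ŷ(y)/2}` for `x ∈ (Δ^tp_Ÿ)^Θ`**: the `log(Ü)`-cocycle is multiplicative there.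
[cite: MochizukiEtTh2009, Prop 1.5 (ii) p.23] -/
theorem logUddFunχ_mul_of_mem_dtpYddTheta
    (x y : ↥((ThetaSetting.modelχ p).GtpYdd.map (ThetaSetting.modelχ p).toTheta))
    (hx : (x : CurveTheta.GTheta (curveχ p)) ∈
      ((ThetaSetting.modelχ p).DtpYddN 1).map (ThetaSetting.modelχ p).toTheta) :
    logUddFunχ p (x * y) = logUddFunχ p x * logUddFunχ p y := by
  unfold logUddFunχ
  rw [← map_mul, ← map_mul]
  refine congrArg (fun t : ↥sqHom.range => deltaThetaCoordχ p (half t)) (Subtype.ext ?_)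
  exact yThetaχ_mul_of_mem_dtpYddTheta p hx _

/-! ### Kernel: `c^{ŷ/2} = 1 ↔ ŷ = 1 ↔ ∈ Δ_Θ` -/

/-- `c^{ŷ(x)/2} = 1 ↔ ŷ(x) = 1` (`t ↦ c^t` is bijective, halving is injective). [cite: MochizukiEtTh2009, Prop 1.5 (ii) p.23] -/
theorem logUddFunχ_eq_one_iff (x : ↥((ThetaSetting.modelχ p).GtpYdd.map (ThetaSetting.modelχ p).toTheta)) :
    logUddFunχ p x = 1 ↔ yThetaχ p x = 1 := by
  unfold logUddFunχ
  rw [← map_one (deltaThetaCoordχ p), (bijective_deltaThetaCoordχ p).1.eq_iff]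
  constructor
  · intro h
    have hsq := half_sq ⟨yThetaχ p x, yThetaχ_mem_range_sqHom p x.2⟩
    rw [h, one_pow] at hsq
    exact hsq.symm
  · intro h
    have ht : (⟨yThetaχ p x, yThetaχ_mem_range_sqHom p x.2⟩ : ↥sqHom.range) = 1 := Subtype.ext h
    rw [ht, map_one]

/-- **On `(Δ^tp_Ÿ)^Θ`: `ŷ(x) = 1 ↔ x ∈ Δ_Θ`** (`⇐`: abc-iut-L6-d5's `yThetaχ_eq_one_of_mem_deltaTheta`; `⇒`: an element
of `Δ^tp_Ÿ` has `right = 1` and all `x`-levels `0`, and `ê_b = 1` kills all `y`-levels). [cite: MochizukiEtTh2009, Prop 1.5 (ii) p.23] -/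
theorem yThetaχ_eq_one_iff_mem_deltaTheta {x : CurveTheta.GTheta (curveχ p)}
    (hx : x ∈ ((ThetaSetting.modelχ p).DtpYddN 1).map (ThetaSetting.modelχ p).toTheta) :
    yThetaχ p x = 1 ↔ x ∈ (ThetaSetting.modelχ p).DeltaTheta := by
  refine ⟨fun h => ?_, fun h => yThetaχ_eq_one_of_mem_deltaTheta p h⟩
  obtain ⟨g, hg, rfl⟩ := hx
  have hright : g.right = 1 := (mem_deltaTempχ_iff p g).mp (Subgroup.mem_inf.mp hg).2
  have hY : g ∈ (ThetaSetting.modelχ p).GtpY :=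
    (ThetaSetting.modelχ p).GtpYdd_le_GtpY ((ThetaSetting.modelχ p).DtpYddN_one_le_GtpYdd hg)
  have hx0 : g.left ∈ gfpSnd.ker := left_mem_ker_of_mem_GtpY hY
  rw [yThetaχ_toTheta] at h
  change CurveTheta.toTheta (curveχ p) g ∈ (CurveTheta.thetaToEll (curveχ p)).ker
  rw [CurveTheta.mk_mem_ker_thetaToEll_iff, mem_ellKerχ_iff]
  refine ⟨fun N => ⟨levelHom_x_eq_zero hx0, ?_⟩, hright⟩
  rw [hHat_y_eq_zero_iff]
  change modN N (yCoordχ p g) = 1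
  rw [h, map_one]

/-! ### Surjectivity: `inl(b^{s²}) ∈ Δ^tp_Ÿ` has `c^{ŷ/2} = c^s` -/

/-- **`inl(b^{s²}) ∈ Δ^tp_Ÿ`**: `pr₂ = 0`, level-`2` shadow `(0, 2s, 0) = (0, 0, 0)`, `aug = 1`.
[cite: MochizukiEtTh2009, §1 p.17] -/
theorem inl_bPowGfp_sq_mem_dtpYddN_one (s : ZH) :
    (SemidirectProduct.inl (bPowGfp (s ^ 2)) : PiTpχ p) ∈ (ThetaSetting.modelχ p).DtpYddN 1 := by
  have hΔ : (SemidirectProduct.inl (bPowGfp (s ^ 2)) : PiTpχ p) ∈ (ThetaSetting.modelχ p).DeltaTemp :=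
    (Subgroup.mem_inf.mp (inl_bPowGfp_mem_dtpY p (s ^ 2))).2
  have haug : (ThetaSetting.modelχ p).aug.toMonoidHom (SemidirectProduct.inl (bPowGfp (s ^ 2)) : PiTpχ p) = 1 := hΔ
  refine Subgroup.mem_inf.mpr ⟨Subgroup.mem_inf.mpr ⟨?_, ?_⟩, hΔ⟩
  · change (SemidirectProduct.inl (bPowGfp (s ^ 2)) : PiTpχ p) ∈ YNχ p (2 * 1)
    rw [mul_one, mem_YNχ_two_iff, SemidirectProduct.left_inl]
    refine Subgroup.mem_inf.mpr ⟨gfpSnd_bPowGfp _, ?_⟩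
    rw [Subgroup.mem_comap, levelHom_bPowGfp, map_pow, toAdd_pow]
    refine ⟨rfl, ?_⟩
    change (2 : ℕ) • Multiplicative.toAdd (ZHatLevel.level 2 s) = (0 : ZMod (2 : ℕ+))
    rw [two_nsmul]
    exact CharTwo.add_self_eq_zero _
  · rw [Subgroup.mem_comap, haug]
    exact Subgroup.one_mem _

/-- `θ(inl(b^{s²})) ∈ (Δ^tp_Ÿ)^Θ`. [cite: MochizukiEtTh2009, §1 p.17] -/
theorem toTheta_inl_bPowGfp_sq_mem_dtpYddTheta (s : ZH) :
    (ThetaSetting.modelχ p).toTheta (SemidirectProduct.inl (bPowGfp (s ^ 2)) : PiTpχ p) ∈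
      ((ThetaSetting.modelχ p).DtpYddN 1).map (ThetaSetting.modelχ p).toTheta :=
  Subgroup.mem_map_of_mem _ (inl_bPowGfp_sq_mem_dtpYddN_one p s)

/-- **`c^{ŷ(inl b^{s²})/2} = c^s`.** [cite: MochizukiEtTh2009, Prop 1.5 (ii) p.23] -/
theorem logUddFunχ_toTheta_inl_bPowGfp_sq (s : ZH) :
    logUddFunχ p ⟨(ThetaSetting.modelχ p).toTheta (SemidirectProduct.inl (bPowGfp (s ^ 2)) : PiTpχ p),
        (ThetaSetting.modelχ p).map_toTheta_DtpYddN_one_le (toTheta_inl_bPowGfp_sq_mem_dtpYddTheta p s)⟩ =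
      deltaThetaCoordχ p s := by
  unfold logUddFunχ
  congr 1
  apply sqHom_injective
  rw [sqHom_apply, sqHom_apply, half_sq]
  change yCoordχ p (SemidirectProduct.inl (bPowGfp (s ^ 2))) = s ^ 2
  unfold yCoordχ
  rw [SemidirectProduct.left_inl, gfpFst_bPowGfp, eHatB_bPow]

/-! ### The standard logarithm of the χ-model -/

/-- **The standard logarithm `λ : (Δ^tp_Ÿ)^Θ → Δ_Θ` of the χ-model**: the restriction of the `log(Ü)`-cocycle
`c^{ŷ/2}` to `(Δ^tp_Ÿ)^Θ` is a continuous HOMOMORPHISM, ONTO `Δ_Θ`, with kernel `Δ_Θ` (abc-iut-L2-t1's `IsStdLog`).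
[cite: MochizukiEtTh2009, Prop 1.5 (ii) p.23] -/
theorem exists_stdLog_modelχ :
    ∃ lam : ↥(((ThetaSetting.modelχ p).DtpYddN 1).map (ThetaSetting.modelχ p).toTheta) →ₜ*
        ↥(ThetaSetting.modelχ p).DeltaTheta,
      ThetaSetting.IsStdLog lam ∧
        ∀ h, lam h = logUddFunχ p ⟨h.1, (ThetaSetting.modelχ p).map_toTheta_DtpYddN_one_le h.2⟩ := by
  refine ⟨⟨MonoidHom.mk' (fun h => logUddFunχ p ⟨h.1, (ThetaSetting.modelχ p).map_toTheta_DtpYddN_one_le h.2⟩)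
      fun x y => ?_, ?_⟩, ⟨?_, ?_⟩, fun h => rfl⟩
  · exact logUddFunχ_mul_of_mem_dtpYddTheta p ⟨x.1, _⟩ ⟨y.1, _⟩ x.2
  · exact (logUddFunχ_mem p).1.comp (continuous_subtype_val.subtype_mk _)
  · intro a
    obtain ⟨s, hs⟩ := (bijective_deltaThetaCoordχ p).2 a
    exact ⟨⟨_, toTheta_inl_bPowGfp_sq_mem_dtpYddTheta p s⟩, (logUddFunχ_toTheta_inl_bPowGfp_sq p s).trans hs⟩
  · intro h
    change logUddFunχ p ⟨h.1, _⟩ = 1 ↔ _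
    rw [logUddFunχ_eq_one_iff]
    exact yThetaχ_eq_one_iff_mem_deltaTheta p h.2

/-! ### `Prop15iiQuot` at the section datum of the χ-model -/

/-- **[EtTh] Prop. 1.5 (ii) «F̈¹/F̈² = Ẑ·log(Ü)» HOLDS at the χ-model, UNCONDITIONALLY**: `Prop15iiQuot` for the
section Kummer datum `kummerDataχSec p` over `compat_modelχ p` — clause (a) by definition of the standard logarithm
`λ` (`res log(Ü) = [λ]` on `(Δ^tp_Ÿ)^Θ`), clauses (b)/(c) by abc-iut-L2-t1's `prop15iiQuot_of_stdLog_of_hasThetaTopology`.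
[cite: MochizukiEtTh2009, Prop 1.5 (ii) p.23] -/
theorem prop15iiQuot_kummerDataχSec : ThetaSetting.Prop15iiQuot (kummerDataχSec p) (compat_modelχ p) := by
  obtain ⟨lam, hstd, hlam⟩ := exists_stdLog_modelχ p
  refine ThetaSetting.prop15iiQuot_of_stdLog_of_hasThetaTopology (compat_modelχ p) (hasThetaTopology_modelχ p)
    (ThetaSetting.modelχ_isEtThOrigin p) hstd ?_
  change ContH1.mk _ _ = ContH1.mk _ _
  exact ContH1.mk_congr _ (funext fun h => (hlam h).symm) _ _

/-- **`hL` at the χ-model**: `log(Ü)^n ∈ F̈² → n = 0` (abc-iut-L2-t1's `Prop15iiQuot.hL_of_origin`).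
[cite: MochizukiEtTh2009, Prop 1.5 (ii) p.23] -/
theorem hL_modelχ {n : ℤ}
    (hn : logUddχ p ^ n ∈ (ThetaSetting.Fdd2 : Subgroup ((ThetaSetting.modelχ p).H1Theta
      ((ThetaSetting.modelχ p).GtpYdd.map (ThetaSetting.modelχ p).toTheta)))) : n = 0 :=
  (prop15iiQuot_kummerDataχSec p).hL_of_origin (ThetaSetting.modelχ_isEtThOrigin p) hn

/-- **`htf` at the χ-model**: `d ∈ F̈¹`, `d² ∈ F̈²` ⇒ `d ∈ F̈²` (abc-iut-L2-t1's `Prop15iiQuot.htf_of_origin`).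
[cite: MochizukiEtTh2009, Prop 1.5 (ii) p.23] -/
theorem htf_modelχ {d : (ThetaSetting.modelχ p).H1Theta ((ThetaSetting.modelχ p).GtpYdd.map (ThetaSetting.modelχ p).toTheta)}
    (hd : d ∈ ThetaSetting.Fdd1 (compat_modelχ p))
    (hsq : d * d ∈ (ThetaSetting.Fdd2 : Subgroup ((ThetaSetting.modelχ p).H1Theta
      ((ThetaSetting.modelχ p).GtpYdd.map (ThetaSetting.modelχ p).toTheta)))) :
    d ∈ (ThetaSetting.Fdd2 : Subgroup ((ThetaSetting.modelχ p).H1Theta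
      ((ThetaSetting.modelχ p).GtpYdd.map (ThetaSetting.modelχ p).toTheta))) :=
  (prop15iiQuot_kummerDataχSec p).htf_of_origin (ThetaSetting.modelχ_isEtThOrigin p) hd hsq

/-- **Prop. 1.5 (ii) ∧ (iii) combined, at the χ-model: `ι` acts by `−1` on `F̈¹/F̈²`** — `InvNegatesFdd1Quot` for the
twisted inversion and EVERY theta companion (abc-iut-L2-t1's `IsInversionAut.invNegatesFdd1Quot` over
`isInversionAut_twistedInversion_modelχ` and `prop15iiQuot_kummerDataχSec`). [cite: MochizukiEtTh2009, Prop 1.5 (iii) p.23] -/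
theorem invNegatesFdd1Quot_modelχ
    (cι : ThetaSetting.ThetaCompanion (Dα := ThetaSetting.modelχ p) (Dβ := ThetaSetting.modelχ p)
      (twistedInversionTop (chi p) (isInducing_leftRightχ p))) :
    (ThetaSetting.modelχ p).InvNegatesFdd1Quot (compat_modelχ p) (isInversionAut_twistedInversion_modelχ p) cι :=
  (isInversionAut_twistedInversion_modelχ p).invNegatesFdd1Quot cι (prop15iiQuot_kummerDataχSec p)

/-- **Census form (NV)**: there are a Theta setting of [EtTh] origin, a `Compat` witness and a Kummer datum for which
the root predicate `Prop15iiQuot` («F̈¹/F̈² = Ẑ·log(Ü)») holds. [cite: MochizukiEtTh2009, Prop 1.5 (ii) p.23] -/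
theorem _root_.Literature.AnabelianGeometry.EtaleTheta.ThetaSetting.exists_isEtThOrigin_prop15iiQuot :
    ∃ (D : ThetaSetting p) (hC : D.Compat) (E : D.KummerData), D.IsEtThOrigin ∧ ThetaSetting.Prop15iiQuot E hC :=
  ⟨ThetaSetting.modelχ p, compat_modelχ p, kummerDataχSec p, ThetaSetting.modelχ_isEtThOrigin p,
    prop15iiQuot_kummerDataχSec p⟩

end Literature.AnabelianGeometry.EtaleTheta.SettingModel

end
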